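import Literature.IUT.HodgeTheaters.InitialThetaDataAbsoluteGalois
import HarnessLib

/-!
# [IUTchI] Def. 3.1 (e): the LOCAL curves `X_v := X_K ×_K K_v`, `C_v := C_K ×_K K_v` of an initial Θ-datum at the
# finite places `v` of `K`, as extensions `Π_{X_v} ↠ G_{K_v}`, `Π_{C_v} ↠ G_{K_v}` over Mathlib's absolute Galois
# group of the completion `K_v`, with their decomposition maps `Π_{X_v} → Π_{X_K}`, `Π_{C_v} → Π_{C_K}`

S. Mochizuki, *Inter-universal Teichmüller theory I*, §3, Definition 3.1 (e) (kurims final manuscript, May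
2020, pp. 62–63) [claim: Mochizuki2012, status: disputed]: "for each `v ∈ 𝕍(K)`, we shall use the subscript
`v` to denote the result of base-changing hyperbolic orbicurves over `F` or `K` to `K_v`. Thus … we have
natural cartesian diagrams `X̲_v → X_v → X_K`, … `Δ_X → Π_{X_v} → Π_{X_K}` … the various profinite groups
`Π_(−)` admit natural outer surjections onto the decomposition group `G_v ⊆ G_K`".

abc-iut cell, GAP B item **GB-13** (`GAP-SIZING-B.md` §2 row D7, LOCAL half; sibling of GB-07's named GLOBAL
model `InitialThetaData.nfCurveModel`).  FILE 1 of the item (independent of GB-07's model file): the local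
curves as objects of abc-iut-L4-t1's interface category `FundamentalExtension`, ASSEMBLED from the tree —
nothing new is posited:

* `localAbsoluteGaloisGrp K v` — `G_{K_v} := Gal(K_v^alg/K_v)` in `ProfiniteGrp` for the completion
  `K_v := v.adicCompletion K` (Mathlib) at a finite place `v : HeightOneSpectrum (𝓞 K)`: the tree's
  `absoluteGaloisGrp` at `K_v` (characteristic zero, as `K ⊆ K_v`);
* `D.localToGFAt v : Gal(K_v^alg/K_v) →* G_F` — the restriction along the chosen `K`-embedding
  `ι_v := localEmb : F̄ → K_v^alg` (`InitialThetaDataLocalGalois.lean`: `localToGF`, Krull-continuous, image the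
  decomposition group `G_v ⊆ G_K`);
* `D.localGalHom U hU v : G_{K_v} →ₜ* aug(U)` for an open subgroup `U ⊆ Π_{C_F}` with `augGF(U) = G_K`
  (`U = Π_{X_K}`: GB-07's `D.openPiXK`, `map_augGF_PiXK`; `U = Π_{C_K}`: `D.openPiCK`, `map_augGF_PiCK`);
* **`D.extLocOf U hU v := (Π_{C_F}.ofOpenSubgroup U).pullback (D.localGalHom U hU v)`** — the base change
  `U ×_{G_F} G_{K_v} ↠ G_{K_v}` by the tree adapters A1 `FundamentalExtension.ofOpenSubgroup` and A8
  `FundamentalExtension.pullback` (`FundamentalExtensionRestriction.lean`, abc-iut-w5-d053); its Galois group IS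
  `localAbsoluteGaloisGrp K v` (`rfl`), so the `[AbsTopIII] CurveModel` field `galIso` at a local curve is the
  identity; **`D.extLocX v`** (`U = Π_{X_K}`: "`Π_{X_v}`") and **`D.extLocC v`** (`U = Π_{C_K}`: "`Π_{C_v}`");
* **the decomposition maps** `D.decompHom U hU v : D.extLocOf U hU v ⟶ Π_{C_F}.ofOpenSubgroup U` (= A8's
  `pullbackι`; target = GB-07's `D.nfCurveModel.ext ⟨XK⟩ / ⟨CK⟩`), PROVED to "arise from a base-change of the
  base field" in the sense of [AbsTopIII] Thm 1.9 p. 38 (`Hom.IsBaseChange`: bijective on `Δ` — the class of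
  homomorphisms `NFPortionAlgorithm.comapBase` is functorial in), and `D.decompHomToCF` into `Π_{C_F}` itself;
* the bridge `D.extLocOfArithEquiv : (D.extLocOf U hU v).arith ≃ₜ* D.PiLoc U (localToGF F K_v ι_v)` to
  abc-iut-L5-t2's presentation `Π_{(−)_v̲} := Π_{(−)} ×_{G_F} Gal(Ω/k)` (`InitialThetaDataLocalGroups.lean`) at
  `k = K_v`, `Ω = K_v^alg`, `ι = ι_v`.

Universe: ONE universe `F K F̄ : Type u` (the discipline of GB-07's model, forced by `CurveModel.{u}`;
`pullback` needs `G_{K_v}` and `Π_{C_F}` in the same universe).  Not here (FILE 2,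
`InitialThetaDataCurveModelLocal.lean`): the `CurveModel` packaging, closed/NF-point decomposition data, the
archimedean Aut-holomorphic input.  "`K_v` is an MLF" is the tree's `isMLF_adicCompletion`
(`NumberFieldValuationProSetDecomposition.lean`), not restated.  Pure profinite-group / Galois plumbing;
nothing of the disputed series is asserted, no side is taken on [IUTchIII] Cor. 3.12; no `instance`, no notation.
-/

noncomputable section

namespace Literature.IUT.HodgeTheaters

open CategoryTheory Topology NumberField IsDedekindDomain
open Literature.AnabelianGeometry.AbsoluteAnabelian

universe u

/-! ### `G_{K_v}` as a profinite group -/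

section LocalGalois

variable (K : Type u) [Field K] [NumberField K] (v : HeightOneSpectrum (𝓞 K))

/-- **`G_{K_v} := Gal(K_v^alg/K_v)`** as an object of `ProfiniteGrp`, for the completion `K_v := v.adicCompletion K`
of the number field `K` at a finite place `v`: the tree's `absoluteGaloisGrp` (Mathlib's
`Field.absoluteGaloisGroup` with the Krull topology) at `K_v`, which has characteristic zero because
`K → K_v` is injective (Def. 3.1 (e): "`G_v`", up to the identification with a decomposition group).
[claim: Mochizuki2012, status: disputed] -/
def localAbsoluteGaloisGrp : ProfiniteGrp.{u} :=
  haveI : CharZero (v.adicCompletion K) :=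
    charZero_of_injective_algebraMap (algebraMap K (v.adicCompletion K)).injective
  absoluteGaloisGrp (v.adicCompletion K)

/-- The carrier of `localAbsoluteGaloisGrp K v` is `Field.absoluteGaloisGroup K_v` (`rfl`).
[claim: Mochizuki2012, status: disputed] -/
theorem coe_localAbsoluteGaloisGrp :
    (localAbsoluteGaloisGrp K v : Type u) = Field.absoluteGaloisGroup (v.adicCompletion K) := rfl

/-- The identity `Gal(K_v^alg/K_v) → (K_v^alg ≃ₐ[K_v] K_v^alg)` (the tree's `Field.absoluteGaloisGroup.toAlgEquiv`,
`MulEquiv.refl`) is continuous: both sides carry the Krull topology. [folklore] -/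
private theorem continuous_toAlgEquiv_adicCompletion :
    Continuous (Field.absoluteGaloisGroup.toAlgEquiv (v.adicCompletion K)) :=
  continuous_def.2 fun _ hs => hs

/-- … and so is its inverse. [folklore] -/
private theorem continuous_toAlgEquiv_symm_adicCompletion :
    Continuous (Field.absoluteGaloisGroup.toAlgEquiv (v.adicCompletion K)).symm :=
  continuous_def.2 fun _ hs => hs

end LocalGalois

namespace InitialThetaData

section LocalCurves

variable {F K Fbar : Type u} [Field F] [NumberField F] [Field K] [NumberField K] [Algebra F K]
  [Field Fbar] [Algebra F Fbar] [Algebra K Fbar] {E : WeierstrassCurve F} [E.IsElliptic] {l : ℕ}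
  {Pb : BadPlacePredicates K} (D : InitialThetaData F K Fbar E l Pb)

/-! ### `ι_v : F̄ → K_v^alg` and `Gal(K_v^alg/K_v) → G_F` -/

/-- **`ι_v : F̄ →ₐ[K] K_v^alg`**, a chosen `K`-embedding of the datum's algebraic closure `F̄` into an algebraic
closure of the completion `K_v` (`InitialThetaDataLocalGalois.lean`'s `localEmb = IsAlgClosed.lift`; any two
choices are `Gal(F̄/K)`-conjugate, `localToGlobal_conj`) (Def. 3.1 (e): the decomposition group "determined, up
to `G_K`-conjugacy, by `v`"). [claim: Mochizuki2012, status: disputed] -/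
def localEmbAt (v : HeightOneSpectrum (𝓞 K)) : Fbar →ₐ[K] AlgebraicClosure (v.adicCompletion K) :=
  haveI := D.normal_K
  localEmb (K := K) (Fbar := Fbar) (AlgebraicClosure (v.adicCompletion K))

/-- **`Gal(K_v^alg/K_v) → G_F = Gal(F̄/F)`**, `σ ↦ ι_v⁻¹ ∘ σ ∘ ι_v` on `F̄` (the tree's `localToGF F K_v ι_v`,
precomposed with the identity `Field.absoluteGaloisGroup.toAlgEquiv`); its image is the decomposition group
`G_v ⊆ G_K ⊆ G_F` (Def. 3.1 (e)). [claim: Mochizuki2012, status: disputed] -/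
def localToGFAt (v : HeightOneSpectrum (𝓞 K)) :
    Field.absoluteGaloisGroup (v.adicCompletion K) →* (Fbar ≃ₐ[F] Fbar) :=
  haveI := D.normal_K
  haveI := D.isScalarTower
  (localToGF F (v.adicCompletion K) (D.localEmbAt v)).comp
    (Field.absoluteGaloisGroup.toAlgEquiv (v.adicCompletion K)).toMonoidHom

/-- Values of `localToGFAt`. [claim: Mochizuki2012, status: disputed] -/
theorem localToGFAt_apply (v : HeightOneSpectrum (𝓞 K)) (σ : Field.absoluteGaloisGroup (v.adicCompletion K)) :
    D.localToGFAt v σ =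
      haveI := D.normal_K
      haveI := D.isScalarTower
      localToGF F (v.adicCompletion K) (D.localEmbAt v)
        (Field.absoluteGaloisGroup.toAlgEquiv (v.adicCompletion K) σ) := rfl

/-- `Gal(K_v^alg/K_v) → G_F` is continuous for the Krull topologies (`continuous_localToGF`).
[claim: Mochizuki2012, status: disputed] -/
theorem continuous_localToGFAt (v : HeightOneSpectrum (𝓞 K)) : Continuous (D.localToGFAt v) := by
  haveI := D.normal_K
  haveI := D.isScalarTower
  exact (continuous_localToGF F (v.adicCompletion K) (D.localEmbAt v)).comp
    (continuous_toAlgEquiv_adicCompletion K v)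

/-- `Gal(K_v^alg/K_v) → G_F` lands in `G_K` (`localToGF_mem`). [claim: Mochizuki2012, status: disputed] -/
theorem localToGFAt_mem (v : HeightOneSpectrum (𝓞 K)) (σ : Field.absoluteGaloisGroup (v.adicCompletion K)) :
    D.localToGFAt v σ ∈ galoisSubgroupOf F K Fbar := by
  haveI := D.normal_K
  haveI := D.isScalarTower
  exact localToGF_mem F (v.adicCompletion K) (D.localEmbAt v) _

/-! ### `G_{K_v} → aug(U)` for an open `U ⊆ Π_{C_F}` over `G_K`, and the base change `U ×_{G_F} G_{K_v}` -/

variable (U : OpenSubgroup D.PiC) (hU : (U : Subgroup D.PiC).map D.augGF = galoisSubgroupOf F K Fbar)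
  (v : HeightOneSpectrum (𝓞 K))

include hU in
/-- For an open subgroup `U ⊆ Π_{C_F}` whose image under `augGF : Π_{C_F} ↠ G_F` is `G_K` (e.g. `Π_{X_K}`,
`Π_{C_K}`: GB-07's `map_augGF_PiXK`, `map_augGF_PiCK`), the element of `G_F` attached to
`σ ∈ Gal(K_v^alg/K_v)` lies in `galIso(aug(U))`. [claim: Mochizuki2012, status: disputed] -/
theorem galFEquiv_symm_localToGFAt_mem (σ : Field.absoluteGaloisGroup (v.adicCompletion K)) :
    D.galFEquiv.symm (D.localToGFAt v σ) ∈ (D.geom.extF.augImage U).toSubgroup := by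
  have h : D.localToGFAt v σ ∈ (D.geom.extF.augImage U).toSubgroup.map
      (D.galFEquiv : D.geom.extF.gal →* (Fbar ≃ₐ[F] Fbar)) := by
    rw [map_galFEquiv_augImage, hU]
    exact D.localToGFAt_mem v σ
  obtain ⟨g, hg, hgσ⟩ := h
  have : D.galFEquiv.symm (D.localToGFAt v σ) = g := by
    rw [← hgσ]
    exact D.galFEquiv.symm_apply_apply g
  rw [this]
  exact hg

/-- **`G_{K_v} →ₜ* aug(U)`** (`= G_{X_K}`, `G_{C_K}`, the Galois group of the adapter `Π_{C_F}.ofOpenSubgroup U`):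
`σ ↦ galIso⁻¹(ι_v⁻¹ ∘ σ ∘ ι_v)`, continuous (Def. 3.1 (e): "`G_v ⊆ G_K`"). [claim: Mochizuki2012, status: disputed] -/
def localGalHom : localAbsoluteGaloisGrp K v →ₜ* (D.geom.extF.ofOpenSubgroup U).gal where
  toMonoidHom :=
    ((D.galFEquiv.symm : (Fbar ≃ₐ[F] Fbar) →* D.geom.extF.gal).comp (D.localToGFAt v)).codRestrict
      (D.geom.extF.augImage U).toSubgroup (D.galFEquiv_symm_localToGFAt_mem U hU v)
  continuous_toFun :=
    (D.galFEquiv.symm.continuous.comp (D.continuous_localToGFAt v)).subtype_mk _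

/-- Values of `localGalHom` in `G`: `galIso⁻¹` of `localToGFAt`. [claim: Mochizuki2012, status: disputed] -/
@[simp] theorem coe_localGalHom_apply (σ : localAbsoluteGaloisGrp K v) :
    (D.localGalHom U hU v σ).1 = D.galFEquiv.symm (D.localToGFAt v σ) := rfl

/-- `galIso` of the value of `localGalHom` is `localToGFAt`. [claim: Mochizuki2012, status: disputed] -/
theorem galIso_localGalHom_apply (σ : localAbsoluteGaloisGrp K v) :
    D.geom.galIso (D.localGalHom U hU v σ).1 = D.localToGFAt v σ :=
  D.galFEquiv.apply_symm_apply _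

/-- **Def. 3.1 (e), the base change `U_v := U ×_{G_F} G_{K_v} ↠ G_{K_v}`** of the curve with open subgroup
`U ⊆ Π_{C_F}` (over `G_K`) to the completion `K_v`, as an extension of profinite groups: the tree adapter A8
`pullback` of A1 `ofOpenSubgroup U` along `localGalHom` ("natural cartesian diagrams … `Π_{X_v} → Π_{X_K}`").
[claim: Mochizuki2012, status: disputed] -/
def extLocOf : FundamentalExtension.{u} :=
  (D.geom.extF.ofOpenSubgroup U).pullback (D.localGalHom U hU v)

/-- The Galois group of `U_v ↠ G_{K_v}` IS `G_{K_v} = localAbsoluteGaloisGrp K v` (`rfl`).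
[claim: Mochizuki2012, status: disputed] -/
theorem extLocOf_gal : (D.extLocOf U hU v).gal = localAbsoluteGaloisGrp K v := rfl

/-- The augmentation of `U_v` is the second projection `(x, σ) ↦ σ`. [claim: Mochizuki2012, status: disputed] -/
@[simp] theorem extLocOf_aug_apply (p : (D.extLocOf U hU v).arith) : (D.extLocOf U hU v).aug p = p.1.2 := rfl

/-- A point `(x, σ)` of `U_v` satisfies `augGF x = ι_v⁻¹ ∘ σ ∘ ι_v` in `G_F`. [claim: Mochizuki2012, status: disputed] -/
theorem augGF_fst_extLocOf (p : (D.extLocOf U hU v).arith) :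
    D.augGF p.1.1.1 = D.localToGFAt v p.1.2 := by
  have h := (D.geom.extF.ofOpenSubgroup U).aug_fst_eq (D.localGalHom U hU v) p
  have h' := congrArg (fun g : (D.geom.extF.ofOpenSubgroup U).gal => D.geom.galIso g.1) h
  rw [augGF_apply]
  simpa only [FundamentalExtension.ofOpenSubgroup_aug_apply_coe, galIso_localGalHom_apply] using h'

/-- **The decomposition map `U_v ⟶ U`** (`Π_{X_v} → Π_{X_K}`, `Π_{C_v} → Π_{C_K}`; on `Π`: `(x, σ) ↦ x`, on
Galois groups: `localGalHom`) — the tree adapter's `pullbackι` (Def. 3.1 (e) "natural cartesian diagrams").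
[claim: Mochizuki2012, status: disputed] -/
def decompHom : D.extLocOf U hU v ⟶ D.geom.extF.ofOpenSubgroup U :=
  (D.geom.extF.ofOpenSubgroup U).pullbackι (D.localGalHom U hU v)

/-- The `Π`-component of the decomposition map is the first projection. [claim: Mochizuki2012, status: disputed] -/
@[simp] theorem decompHom_arith_apply (p : (D.extLocOf U hU v).arith) : (D.decompHom U hU v).arith p = p.1.1 := rfl

/-- The `G`-component of the decomposition map is `localGalHom`. [claim: Mochizuki2012, status: disputed] -/
@[simp] theorem decompHom_gal : (D.decompHom U hU v).gal = D.localGalHom U hU v := rfl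

/-- **The decomposition map arises from a base change of the base field** ([AbsTopIII] Thm 1.9 p. 38:
"homomorphisms of extensions of profinite groups arising from a base-change of the base field"; the tree's
`Hom.IsBaseChange` = bijective on `Δ`: "`Δ_X → Π_{X_v} → Π_{X_K}`", the geometric fundamental group is
unchanged) — `isBaseChange_pullbackι`. [claim: Mochizuki2012, status: disputed] -/
theorem isBaseChange_decompHom : FundamentalExtension.Hom.IsBaseChange (D.decompHom U hU v) :=
  (D.geom.extF.ofOpenSubgroup U).isBaseChange_pullbackι (D.localGalHom U hU v)

/-- **`U_v ⟶ Π_{C_F}`**: the decomposition map followed by the open immersion `U ↪ Π_{C_F}` (adapter A1's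
`ofOpenSubgroupι`, open injective). [claim: Mochizuki2012, status: disputed] -/
def decompHomToCF : D.extLocOf U hU v ⟶ D.geom.extF :=
  D.decompHom U hU v ≫ D.geom.extF.ofOpenSubgroupι U

/-- The `Π`-component of `U_v ⟶ Π_{C_F}` is `(x, σ) ↦ x`. [claim: Mochizuki2012, status: disputed] -/
@[simp] theorem decompHomToCF_arith_apply (p : (D.extLocOf U hU v).arith) :
    (D.decompHomToCF U hU v).arith p = p.1.1.1 := rfl

/-- The `G`-component of `U_v ⟶ Π_{C_F}` is `σ ↦ galIso⁻¹(ι_v⁻¹ ∘ σ ∘ ι_v)`. [claim: Mochizuki2012, status: disputed] -/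
@[simp] theorem decompHomToCF_gal_apply (σ : (D.extLocOf U hU v).gal) :
    (D.decompHomToCF U hU v).gal σ = D.galFEquiv.symm (D.localToGFAt v σ) := rfl

/-- The image of `U_v → Π_{C_F}` lies in `U`. [claim: Mochizuki2012, status: disputed] -/
theorem decompHomToCF_arith_mem (p : (D.extLocOf U hU v).arith) :
    (D.decompHomToCF U hU v).arith p ∈ (U : Subgroup D.PiC) := p.1.1.2

/-! ### Bridge to `Π_{(−)_v̲} := Π_{(−)} ×_{G_F} Gal(Ω/k)` of `InitialThetaDataLocalGroups.lean` -/

/-- **`U_v ≃ₜ* D.PiLoc U (localToGF F K_v ι_v)`**: the adapter presentation `U ×_{aug(U)} G_{K_v}` and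
abc-iut-L5-t2's presentation `Π_{(−)} ×_{G_F} Gal(K_v^alg/K_v)` (pairs `(x, σ)` with `x ∈ U`, `augGF x = σ|_{F̄}`) are
the same subgroup of `Π_{C_F} × Gal(K_v^alg/K_v)` up to the identity `Field.absoluteGaloisGroup.toAlgEquiv`;
bicontinuously. [claim: Mochizuki2012, status: disputed] -/
def extLocOfArithEquiv :
    haveI := D.normal_K
    haveI := D.isScalarTower
    (D.extLocOf U hU v).arith ≃ₜ*
      D.PiLoc (U : Subgroup D.PiC) (localToGF F (v.adicCompletion K) (D.localEmbAt v)) :=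
  haveI := D.normal_K
  haveI := D.isScalarTower
  { toFun := fun p =>
      ⟨(p.1.1.1, Field.absoluteGaloisGroup.toAlgEquiv (v.adicCompletion K) p.1.2),
        (D.mem_PiLoc _ _ _).2 ⟨p.1.1.2, D.augGF_fst_extLocOf U hU v p⟩⟩
    invFun := fun z =>
      ⟨(⟨z.1.1, ((D.mem_PiLoc _ _ _).1 z.2).1⟩,
          (Field.absoluteGaloisGroup.toAlgEquiv (v.adicCompletion K)).symm z.1.2), by
        rw [FundamentalExtension.mem_pullbackSubgroup_iff]
        apply Subtype.ext
        apply D.geom.galIso.injective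
        rw [FundamentalExtension.ofOpenSubgroup_aug_apply_coe, galIso_localGalHom_apply]
        exact ((D.mem_PiLoc _ _ _).1 z.2).2⟩
    left_inv := fun _ => rfl
    right_inv := fun _ => rfl
    map_mul' := fun _ _ => rfl
    continuous_toFun := by
      apply Continuous.subtype_mk
      exact ((continuous_subtype_val.comp continuous_fst).prodMk
        ((continuous_toAlgEquiv_adicCompletion K v).comp continuous_snd)).comp continuous_subtype_val
    continuous_invFun := by
      apply Continuous.subtype_mk
      exact ((continuous_fst.comp continuous_subtype_val).subtype_mk _).prodMk
        ((continuous_toAlgEquiv_symm_adicCompletion K v).comp (continuous_snd.comp continuous_subtype_val)) }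

/-- On the `Π_{C_F}`-component the bridge is the identity. [claim: Mochizuki2012, status: disputed] -/
@[simp] theorem extLocOfArithEquiv_apply_fst (p : (D.extLocOf U hU v).arith) :
    (D.extLocOfArithEquiv U hU v p).1.1 = p.1.1.1 := rfl

/-! ### The two local curves of the datum: `X_v` and `C_v` -/

/-- **`Π_{X_v} ↠ G_{K_v}`**, the local curve **`X_v := X_K ×_K K_v`** (Def. 3.1 (e)) as an extension of profinite
groups: `extLocOf` at `Π_{X_K}` (GB-07's `D.openPiXK`, `map_augGF_PiXK`). [claim: Mochizuki2012, status: disputed] -/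
def extLocX (v : HeightOneSpectrum (𝓞 K)) : FundamentalExtension.{u} := D.extLocOf D.openPiXK D.map_augGF_PiXK v

/-- **`Π_{C_v} ↠ G_{K_v}`**, the local orbicurve **`C_v := C_K ×_K K_v`** (Def. 3.1 (e)): `extLocOf` at `Π_{C_K}`
(GB-07's `D.openPiCK`, `map_augGF_PiCK`). [claim: Mochizuki2012, status: disputed] -/
def extLocC (v : HeightOneSpectrum (𝓞 K)) : FundamentalExtension.{u} := D.extLocOf D.openPiCK D.map_augGF_PiCK v

/-- `extLocX` unfolds to `extLocOf` at `Π_{X_K}` (`rfl`). [claim: Mochizuki2012, status: disputed] -/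
theorem extLocX_eq (v : HeightOneSpectrum (𝓞 K)) : D.extLocX v = D.extLocOf D.openPiXK D.map_augGF_PiXK v := rfl

/-- `extLocC` unfolds to `extLocOf` at `Π_{C_K}` (`rfl`). [claim: Mochizuki2012, status: disputed] -/
theorem extLocC_eq (v : HeightOneSpectrum (𝓞 K)) : D.extLocC v = D.extLocOf D.openPiCK D.map_augGF_PiCK v := rfl

/-- `G_{X_v} = G_{K_v}` (`rfl`). [claim: Mochizuki2012, status: disputed] -/
theorem extLocX_gal (v : HeightOneSpectrum (𝓞 K)) : (D.extLocX v).gal = localAbsoluteGaloisGrp K v := rfl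

/-- `G_{C_v} = G_{K_v}` (`rfl`). [claim: Mochizuki2012, status: disputed] -/
theorem extLocC_gal (v : HeightOneSpectrum (𝓞 K)) : (D.extLocC v).gal = localAbsoluteGaloisGrp K v := rfl

/-- **`Π_{X_v} ⟶ Π_{X_K}`**, the decomposition map of `X_v → X_K` (target = GB-07's `D.nfCurveModel.ext ⟨XK⟩`),
arising from a base change (`isBaseChange_decompHom`). [claim: Mochizuki2012, status: disputed] -/
def decompHomX (v : HeightOneSpectrum (𝓞 K)) : D.extLocX v ⟶ D.geom.extF.ofOpenSubgroup D.openPiXK := D.decompHom D.openPiXK D.map_augGF_PiXK v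

/-- **`Π_{C_v} ⟶ Π_{C_K}`**, the decomposition map of `C_v → C_K` (target = GB-07's `D.nfCurveModel.ext ⟨CK⟩`).
[claim: Mochizuki2012, status: disputed] -/
def decompHomC (v : HeightOneSpectrum (𝓞 K)) : D.extLocC v ⟶ D.geom.extF.ofOpenSubgroup D.openPiCK := D.decompHom D.openPiCK D.map_augGF_PiCK v

/-- `Π_{X_v} → Π_{X_K}` arises from a base change of the base field (bijective on `Δ`).
[claim: Mochizuki2012, status: disputed] -/
theorem isBaseChange_decompHomX (v : HeightOneSpectrum (𝓞 K)) : FundamentalExtension.Hom.IsBaseChange (D.decompHomX v) :=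
  D.isBaseChange_decompHom _ _ v

/-- `Π_{C_v} → Π_{C_K}` arises from a base change of the base field (bijective on `Δ`).
[claim: Mochizuki2012, status: disputed] -/
theorem isBaseChange_decompHomC (v : HeightOneSpectrum (𝓞 K)) : FundamentalExtension.Hom.IsBaseChange (D.decompHomC v) :=
  D.isBaseChange_decompHom _ _ v

/-- `Π_{X_v} ⊆ Π_{C_v}` over `G_{K_v}`: the inclusion `X_v → C_v` of local curves as a homomorphism of extensions
(identity on `G_{K_v}`; on `Π` the inclusion `Π_{X_K} ⊆ Π_{C_K}`, `PiXK = PiX ⊓ PiCK`).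
[claim: Mochizuki2012, status: disputed] -/
def locXToC (v : HeightOneSpectrum (𝓞 K)) : D.extLocX v ⟶ D.extLocC v where
  arith :=
    { toFun := fun p => ⟨(⟨p.1.1.1, (p.1.1.2 : p.1.1.1 ∈ D.PiXK).2⟩, p.1.2), by
        rw [FundamentalExtension.mem_pullbackSubgroup_iff]
        apply Subtype.ext
        change D.geom.extF.aug p.1.1.1 = D.galFEquiv.symm (D.localToGFAt v p.1.2)
        have h := (D.geom.extF.ofOpenSubgroup D.openPiXK).aug_fst_eq (D.localGalHom _ D.map_augGF_PiXK v) p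
        exact congrArg Subtype.val h⟩
      map_one' := rfl
      map_mul' := fun _ _ => rfl
      continuous_toFun := by
        apply Continuous.subtype_mk
        have h1 : Continuous fun p : (D.extLocX v).arith => p.1.1.1 :=
          continuous_subtype_val.comp (continuous_fst.comp continuous_subtype_val)
        have h2 : Continuous fun p : (D.extLocX v).arith => p.1.2 :=
          continuous_snd.comp continuous_subtype_val
        exact (h1.subtype_mk _).prodMk h2 }
  gal := ContinuousMonoidHom.id _
  comm := fun _ => rfl

/-- On `Π_{C_F}`-components `X_v → C_v` is the identity. [claim: Mochizuki2012, status: disputed] -/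
@[simp] theorem locXToC_arith_apply_coe (v : HeightOneSpectrum (𝓞 K)) (p : (D.extLocX v).arith) :
    ((D.locXToC v).arith p).1.1.1 = p.1.1.1 := rfl

end LocalCurves

end InitialThetaData

end Literature.IUT.HodgeTheaters

end
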